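import Literature.NumberTheory.Automorphic.IdeleClassGaloisRep
import Literature.NumberTheory.Automorphic.IdeleClassGroupNormIndex
import Literature.Algebra.Homology.FiniteCyclicH2CarryCocycle
import HarnessLib

/-!
# `#H²(Gal(E/F), C_E) = [E : F]` for a CYCLIC extension of number fields — the `H²` count of the global
# class formation at cyclic layers (Tate, Cassels–Fröhlich Ch. VII §9 Thm. 9.1, Step 2 of its proof:
# `Ĥ⁰ ≃ Ĥ²` and `[Ĥ⁰(G, C_L)] = [C_K : N_{L/K} C_L] = n`)

Topic `NumberTheory/Automorphic` (ideles, idele classes); namespace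
`Literature.NumberTheory.Automorphic.IdeleClassGroup`.  Proof file: theorems only (no definition, no named fact,
no instance; D-0026).  Sequel to `IdeleClassGaloisRep` (`galoisRep F E : Rep ℤ Gal(E/F)` on `Additive C_E`, axiom I)
and `IdeleClassGroupNormIndex` (`#(C_E^G / N̄ C_E) = [E:F]` for cyclic `E/F`, on classes), read through the tree's
`Algebra/Homology/FiniteCyclicH2CarryCocycle` (Serre VIII §4: `H²(G, A) ≅ A^G / N_G A` for a finite cyclic `G`,
`FiniteCyclic.normResidueCarryEquiv`).

* §1 dictionary between the representation and the class group: invariants of `galoisRep F E` = the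
  `Gal(E/F)`-fixed classes = `ι(C_F)` (`toAddSubgroup_invariants_galoisRep`), the norm `N = Σ_g ρ(g)` of the
  representation is the Galois norm `N̄` on classes (`norm_galoisRep_apply`, `toAddSubgroup_range_norm_galoisRep`).
* §2 **`natCard_H2_galoisRep`** — for `E/F` cyclic, `Nat.card (groupCohomology (galoisRep F E) 2) = [E : F]`:
  `#H²(Gal(E/F), C_E) = #(C_E^G / N̄ C_E) = [C_F : N_{E/F} C_E] = [E : F]` (norm index equality).  This is the
  order statement of axiom II at cyclic layers (the generator / invariant bookkeeping is not addressed here).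

## References

* J. W. S. Cassels, A. Fröhlich (eds.), *Algebraic Number Theory* (1967), Ch. VII (J. Tate) §9 Thm. 9.1 (proof,
  Step 2), §5.1 Main Theorem (B). [CasselsFrohlichANT1967]
* J.-P. Serre, *Local Fields*, GTM 67 (1979), Ch. VIII §4 (cohomology of finite cyclic groups). [SerreLocalFields1979]
-/

noncomputable section

open NumberField CategoryTheory groupCohomology
open scoped NumberField

namespace Literature.NumberTheory.Automorphic

namespace IdeleClassGroup

open Literature.NumberTheory.GaloisRepresentations Literature.Algebra.Homology

variable {F E : Type} [Field F] [Field E] [Algebra F E] [NumberField F] [NumberField E]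

/-! ## §1. Dictionary: invariants and norm of `galoisRep F E` -/

omit [NumberField F] in
/-- The invariants of `galoisRep F E` are the `Gal(E/F)`-fixed idele classes.
[cite: CasselsFrohlichANT1967, Ch. VII §8 (the `G`-module `C_L`)] -/
theorem mem_invariants_galoisRep (x : Additive (IdeleClassGroup E)) :
    x ∈ (galoisRep F E).ρ.invariants ↔ ∀ g : E ≃ₐ[F] E, classGalAct g (Additive.toMul x) = Additive.toMul x := by
  change (∀ g : E ≃ₐ[F] E, (galoisRep F E).ρ g x = x) ↔ _
  refine forall_congr' fun g => ⟨fun h => ?_, fun h => ?_⟩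
  · exact congrArg Additive.toMul h
  · exact congrArg Additive.ofMul h

/-- **`(C_E)^{Gal(E/F)} = ι(C_F)` for the representation**: the invariants of `galoisRep F E` are, as an additive
subgroup of `Additive C_E`, the range of `classBaseChange F E` (`mem_range_classBaseChange_iff`).
[cite: CasselsFrohlichANT1967, Ch. VII §8 Prop. 8.1] -/
theorem toAddSubgroup_invariants_galoisRep [IsGalois F E] :
    (galoisRep F E).ρ.invariants.toAddSubgroup = Subgroup.toAddSubgroup (classBaseChange F E).range := by
  ext x
  refine ⟨fun h => ?_, fun h => ?_⟩
  · exact (mem_range_classBaseChange_iff (F := F) (Additive.toMul x)).2 ((mem_invariants_galoisRep x).1 h)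
  · exact (mem_invariants_galoisRep x).2 ((mem_range_classBaseChange_iff (F := F) (Additive.toMul x)).1 h)

/-- On classes, the product of all Galois conjugates is the Galois norm `N̄`.
[cite: CasselsFrohlichANT1967, Ch. VII §8] -/
theorem prod_classGalAct_eq_classGalNorm (c : IdeleClassGroup E) :
    ∏ g : E ≃ₐ[F] E, classGalAct g c = classGalNorm F E c := by
  induction c using QuotientGroup.induction_on with
  | H y =>
    rw [classGalNorm_mk, AdeleRing.ideleGalNorm_apply, QuotientGroup.mk_prod]
    exact Finset.prod_congr rfl fun g _ => classGalAct_mk g y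

/-- The norm `N = Σ_g ρ(g)` of the representation `galoisRep F E` is the Galois norm on classes:
`N x = N̄ x`. [cite: CasselsFrohlichANT1967, Ch. VII §8] -/
theorem norm_galoisRep_apply (x : Additive (IdeleClassGroup E)) :
    (galoisRep F E).ρ.norm x = Additive.ofMul (classGalNorm F E (Additive.toMul x)) := by
  rw [Representation.norm, LinearMap.sum_apply, ← prod_classGalAct_eq_classGalNorm, ofMul_prod]
  rfl

/-- **`N(C_E) = N̄(C_E)` for the representation**: the range of the norm of `galoisRep F E` is, as an additive
subgroup, the range of `classGalNorm F E`. [cite: CasselsFrohlichANT1967, Ch. VII §8] -/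
theorem toAddSubgroup_range_norm_galoisRep :
    (LinearMap.range (galoisRep F E).ρ.norm).toAddSubgroup = Subgroup.toAddSubgroup (classGalNorm F E).range := by
  ext x
  change x ∈ LinearMap.range (galoisRep F E).ρ.norm ↔
    ∃ c : IdeleClassGroup E, classGalNorm F E c = Additive.toMul (α := IdeleClassGroup E) x
  rw [LinearMap.mem_range]
  constructor
  · rintro ⟨y, rfl⟩
    exact ⟨Additive.toMul y, by rw [norm_galoisRep_apply]; rfl⟩
  · rintro ⟨c, hc⟩
    refine ⟨Additive.ofMul c, ?_⟩
    rw [norm_galoisRep_apply]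
    exact (congrArg Additive.ofMul hc).trans rfl

/-! ## §2. The `H²` count at a cyclic layer -/

/-- The range of `N̄ : M_G → M^G` is the norm subgroup cut back to the invariants: as an additive subgroup of
`M^G`, `range N̄ = (range N) ∩ M^G` (the tree's `mem_range_normBar_iff`). [cite: SerreLocalFields1979, Ch. VIII §4] -/
theorem toAddSubgroup_range_normBar_galoisRep :
    (LinearMap.range (normBar (galoisRep F E).ρ)).toAddSubgroup =
      (LinearMap.range (galoisRep F E).ρ.norm).toAddSubgroup.addSubgroupOf
        (galoisRep F E).ρ.invariants.toAddSubgroup := by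
  ext x
  rw [Submodule.mem_toAddSubgroup, mem_range_normBar_iff, AddSubgroup.mem_addSubgroupOf,
    Submodule.mem_toAddSubgroup]

/-- **`#H²(Gal(E/F), C_E) = [E : F]` for a cyclic extension of number fields** (Tate, Cassels–Fröhlich VII §9,
Step 2 of the proof of Thm. 9.1: `Ĥ⁰ ≃ Ĥ²` for cyclic `G` and `[Ĥ⁰(G, C_L)] = [C_K : N_{L/K} C_L] = n`).  Proof:
`H²(G, A) ≅ A^G / N_G A` (`FiniteCyclic.normResidueCarryEquiv`, Serre VIII §4) for `A = galoisRep F E`;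
`A^G = ι(C_F)` and `N_G A = N̄(C_E)` (§1); and the norm classes have index `[E:F]` in the fixed classes
(`relIndex_range_classGalNorm`, the norm index equality). [cite: CasselsFrohlichANT1967, Ch. VII §9 Thm. 9.1 (proof, Step 2)] -/
theorem natCard_H2_galoisRep [IsGalois F E] [IsCyclic (E ≃ₐ[F] E)] :
    Nat.card (groupCohomology (galoisRep F E) 2) = Module.finrank F E := by
  classical
  obtain ⟨σ, hσ⟩ := IsCyclic.exists_generator (α := E ≃ₐ[F] E)
  rw [← Nat.card_congr (FiniteCyclic.normResidueCarryEquiv σ hσ (galoisRep F E)).toEquiv]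
  have h1 : Nat.card ((galoisRep F E).ρ.invariants ⧸ LinearMap.range (normBar (galoisRep F E).ρ)) =
      (LinearMap.range (normBar (galoisRep F E).ρ)).toAddSubgroup.index :=
    (AddSubgroup.index_eq_card _).symm
  rw [h1, toAddSubgroup_range_normBar_galoisRep]
  change ((LinearMap.range (galoisRep F E).ρ.norm).toAddSubgroup).relIndex
      (galoisRep F E).ρ.invariants.toAddSubgroup = Module.finrank F E
  rw [toAddSubgroup_range_norm_galoisRep, toAddSubgroup_invariants_galoisRep]
  exact (Subgroup.relIndex_toAddSubgroup (H := (classGalNorm F E).range)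
    (K := (classBaseChange F E).range)).trans relIndex_range_classGalNorm

/-! ## §3. Dictionary for sub-layers: `N`-invariants of `galoisRep F E` are the classes of `E^N` -/

/-- **Galois descent at a sub-layer, representation currency**: for a subgroup `N ≤ Gal(E/F)` with fixed field
`E^N`, a vector of `galoisRep F E` is fixed by `N` (i.e. lies in the invariants of the restricted representation
`Rep.res N.subtype (galoisRep F E)`) iff the underlying idele class is the base change of a class of `E^N`
(`mem_range_classBaseChange_iff` for the Galois layer `E/E^N`, transported along `N ≃* Gal(E/E^N)`,
`IntermediateField.subgroupEquivAlgEquiv`).  This identifies the module `(C_E)^N` of the quotient layers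
`(Rep.res U.subtype _).quotientToInvariants N` of the tree's `Algebra/Homology` formation files with `C_{E^N}`.
[cite: CasselsFrohlichANT1967, Ch. VII §8 Prop. 8.1] -/
theorem mem_invariants_res_galoisRep_iff [IsGalois F E] (N : Subgroup (E ≃ₐ[F] E))
    (x : Additive (IdeleClassGroup E)) :
    x ∈ (Rep.res N.subtype (galoisRep F E)).ρ.invariants ↔
      Additive.toMul x ∈ (classBaseChange (IntermediateField.fixedField N) E).range := by
  haveI : IsGalois (IntermediateField.fixedField N) E :=
    IsGalois.tower_top_of_isGalois F (IntermediateField.fixedField N) E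
  set e := IntermediateField.subgroupEquivAlgEquiv N with he
  have hres : ∀ τ : E ≃ₐ[IntermediateField.fixedField N] E,
      ((e.symm τ : N) : E ≃ₐ[F] E) = τ.restrictScalars F := fun τ => by
    conv_rhs => rw [← e.apply_symm_apply τ]
    exact AlgEquiv.ext fun _ => rfl
  rw [mem_range_classBaseChange_iff (F := IntermediateField.fixedField N)]
  change (∀ n : N, (galoisRep F E).ρ (n : E ≃ₐ[F] E) x = x) ↔ _
  constructor
  · intro h τ
    rw [← classGalAct_restrictScalars (F := F), ← hres]
    exact congrArg Additive.toMul (h (e.symm τ))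
  · intro h n
    have hn : (n : E ≃ₐ[F] E) = (e n).restrictScalars F := by rw [← hres, e.symm_apply_apply]
    have h' := h (e n)
    rw [← classGalAct_restrictScalars (F := F), ← hn] at h'
    exact congrArg Additive.ofMul h'

end IdeleClassGroup

end Literature.NumberTheory.Automorphic

end
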